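import Mathlib

/-!
# Product-plus-one line — CLOUD CORE in lens currency: the two-envelope form of the phase velocity and
# the PHASE-MONOTONICITY LAWS (one-sided phase windows carry at most one sign change)

Helper file for `stmt-ValiantsHypothesis-18050` (`MatrixDescartes`), line `product_plus_one`, floor
`stub_oneChangeFloorK3` (open core (CL-F1) = companies of one-change TRINOMIAL rows = clouds).  Def-free,
Mathlib only.  Nothing here closes a stub; VP ≠ VNP is not touched.

## Dictionary (books of record: val-lit-p3 g20 NOTE `pub/val-lit/lmr/NOTE-p3g20-18050-phase-lens.md` §8)
For the floor at `K = 3`, support `d 0 < d 1 < d 2`, put `a := d 1 - d 0`, `c := d 2 - d 0`, `b := c - a`,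
`ψ := π a / c`, `u := log x`.  A trinomial row `f = α + β x^a + γ x^c` (`β ≠ 0`) has, on the lens line
`x = e^{iψ} e^u`, the phase `arg f = const + arccot x_f(u)` with
`x_f(u) = cot ψ + (p_f e^{-a u} + r_f e^{b u}) / sin ψ`, `p_f = α/β`, `r_f = -γ/β` (NOTE §8.1), and the lens
inequality (NOTE §2, PAPER) bounds the floor's Euler count `#{H = ν}` by the real poles in the strip plus
`1 + S⁻(F₁)`, `F₁ = (d/du) Σ_f arccot x_f = -Σ_f x_f' / (1 + x_f²)`.  The located open law is
(CL-1′) `S⁻(F₁) ≤ 2T` for `T` clouds.  Below a row is the triple `(κ, p, r)` with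
`y(u) = κ + p·exp(-a u) + r·exp(b u)` (so `y = x_f` with `κ = cot ψ`, `(p, r) = (p_f, r_f)/sin ψ`), and the
company phase is `Θ(u) = Σ_i arctan (y_i u)`; `Θ' = -F₁`, same sign changes.

## What is proved (all rows of a company share `a, b, κ`; `ι` a finite index type)
* `hasDerivAt_phase` : `Θ'(u) = Σ_i y_i'(u) / (1 + y_i(u)²)`, `y_i' = -a p_i e^{-au} + b r_i e^{bu}`.
* `phaseVelocity_eq_exp_mul` (TWO-ENVELOPE FORM): `Θ'(u) = e^{bu} · R(u)` with the REDUCED VELOCITY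
  `R(u) = Σ_i (-a p_i e^{-(a+b)u} + b r_i) / (1 + y_i(u)²)` — for a pure T5 company (`p_i, r_i < 0`)
  this is `e^{-(a+b)u}·A(u) - B(u)` with two POSITIVE envelopes `A = Σ a|p_i|/(1+y_i²)`,
  `B = Σ b|r_i|/(1+y_i²)`: the zeros of `F₁` are the solutions of `A(u)/B(u) = e^{(a+b)u}`, a weighted
  mean of the row switch heights `e^{(a+b)u_i*} = a|p_i|/(b|r_i|)` against one exponential.
* `hasDerivAt_reducedVelocity` : the derivative of `R`, summand by summand, is
  `(a(a+b) p_i e^{-(a+b)u}·(1+y_i²) - c_i·(2 y_i y_i')) / (1+y_i²)²` with `y_i' = e^{bu} c_i`,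
  `c_i = -a p_i e^{-(a+b)u} + b r_i` — the cross term is `2 e^{bu} y_i c_i²`, a SQUARE times the phase.
* PHASE-MONOTONICITY LAW `reducedVelocity_deriv_nonpos` / `_neg`: if every row is LOWER-OPPOSED
  (`p_i ≤ 0`, i.e. `α_f β_f ≤ 0`: types T5, the dip T2, a-poles, and all rows with `α_f = 0`) and the
  window is a POSITIVE-PHASE window (`y_i(u) ≥ 0` for every row, i.e. every `arccot x_f ≤ π/2`), then
  `R' ≤ 0` there (`< 0` as soon as one `p_i < 0`); hence (`reducedVelocity_strictAntiOn`,
  `phaseVelocity_zero_subsingleton`) on such a window `R` is strictly decreasing, `Θ' = e^{bu} R` vanishes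
  at most once and has at most one sign change: a positive-phase window of a lower-opposed cloud company
  contributes at most ONE sign change to (CL-1′), for every number of clouds and every support.
  (The mirror laws — `r_i ≤ 0` with the factorisation `Θ' = e^{-au}·L`, and the negative-phase versions with
  reversed monotonicity — are the same computation with `a ↔ b`, `u ↔ -u`; not repeated here.)
Honest label: a window law in lens currency (the lens inequality itself is paper, NOTE §2); it does not bound
the number of such windows.
-/

set_option linter.dupNamespace false

open Real Finset BigOperators

namespace Summit.ValiantsHypothesis.ValiantsHypothesis.Theorems.LacunarySymmetroidMatrixDescartes.ProductPlusOne.LensCloudEnvelope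

variable {ι : Type*} [Fintype ι]

/-- `e^{bu} · e^{-(a+b)u} = e^{-au}`. [folklore] -/
theorem exp_mul_exp_neg_add (a b u : ℝ) : exp (b * u) * exp (-((a + b) * u)) = exp (-(a * u)) := by
  rw [← Real.exp_add]; ring_nf

/-- **Row velocity envelope**: `y' = -a p e^{-au} + b r e^{bu} = e^{bu}·(-a p e^{-(a+b)u} + b r)`.
[this file's lemma] -/
theorem rowVelocity_eq (a b p r u : ℝ) :
    -(a * p) * exp (-(a * u)) + b * r * exp (b * u)
      = exp (b * u) * (-(a * p) * exp (-((a + b) * u)) + b * r) := by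
  have h := exp_mul_exp_neg_add a b u
  linear_combination (a * p) * h

/-- derivative of one row `y(u) = κ + p e^{-au} + r e^{bu}`. [this file's lemma] -/
theorem hasDerivAt_row (a b κ p r u : ℝ) :
    HasDerivAt (fun u => κ + p * exp (-(a * u)) + r * exp (b * u))
      (-(a * p) * exp (-(a * u)) + b * r * exp (b * u)) u := by
  have h1 : HasDerivAt (fun u : ℝ => -(a * u)) (-a) u := by
    simpa using (hasDerivAt_id u).const_mul (-a)
  have h2 : HasDerivAt (fun u : ℝ => exp (-(a * u))) (exp (-(a * u)) * (-a)) u := h1.exp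
  have h3 : HasDerivAt (fun u : ℝ => b * u) b u := by
    simpa using (hasDerivAt_id u).const_mul b
  have h4 : HasDerivAt (fun u : ℝ => exp (b * u)) (exp (b * u) * b) u := h3.exp
  have h5 := ((h2.const_mul p).const_add κ).add (h4.const_mul r)
  exact h5.congr_deriv (by ring)

/-- derivative of one row's phase `arctan y(u)`. [this file's lemma] -/
theorem hasDerivAt_arctan_row (a b κ p r u : ℝ) :
    HasDerivAt (fun u => arctan (κ + p * exp (-(a * u)) + r * exp (b * u)))
      ((-(a * p) * exp (-(a * u)) + b * r * exp (b * u))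
        / (1 + (κ + p * exp (-(a * u)) + r * exp (b * u)) ^ 2)) u := by
  have h := (hasDerivAt_row a b κ p r u).arctan
  exact h.congr_deriv (by ring)

/-- **The company phase velocity** `Θ'(u) = Σ_i y_i'/(1 + y_i²)` (`= -F₁`). [this file's theorem] -/
theorem hasDerivAt_phase (a b κ u : ℝ) (p r : ι → ℝ) :
    HasDerivAt (fun u => ∑ i, arctan (κ + p i * exp (-(a * u)) + r i * exp (b * u)))
      (∑ i, (-(a * p i) * exp (-(a * u)) + b * r i * exp (b * u))
        / (1 + (κ + p i * exp (-(a * u)) + r i * exp (b * u)) ^ 2)) u := by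
  have h := HasDerivAt.sum (u := (Finset.univ : Finset ι))
    (fun i _ => hasDerivAt_arctan_row a b κ (p i) (r i) u)
  have e : (∑ i, fun v : ℝ => arctan (κ + p i * exp (-(a * v)) + r i * exp (b * v)))
      = fun v => ∑ i, arctan (κ + p i * exp (-(a * v)) + r i * exp (b * v)) := by
    funext v
    exact Finset.sum_apply v Finset.univ _
  rw [e] at h
  exact h

/-- **TWO-ENVELOPE FORM**: `Θ'(u) = e^{bu} · R(u)`, `R(u) = Σ_i (-a p_i e^{-(a+b)u} + b r_i)/(1 + y_i²)`.
[this file's theorem] -/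
theorem phaseVelocity_eq_exp_mul (a b κ u : ℝ) (p r : ι → ℝ) :
    ∑ i, (-(a * p i) * exp (-(a * u)) + b * r i * exp (b * u))
        / (1 + (κ + p i * exp (-(a * u)) + r i * exp (b * u)) ^ 2)
      = exp (b * u) * ∑ i, (-(a * p i) * exp (-((a + b) * u)) + b * r i)
        / (1 + (κ + p i * exp (-(a * u)) + r i * exp (b * u)) ^ 2) := by
  rw [Finset.mul_sum]
  refine Finset.sum_congr rfl fun i _ => ?_
  rw [rowVelocity_eq, mul_div_assoc]

/-- the sign of `Θ'` is the sign of the reduced velocity `R`. [this file's lemma] -/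
theorem phaseVelocity_pos_iff (a b κ u : ℝ) (p r : ι → ℝ) :
    0 < ∑ i, (-(a * p i) * exp (-(a * u)) + b * r i * exp (b * u))
        / (1 + (κ + p i * exp (-(a * u)) + r i * exp (b * u)) ^ 2)
      ↔ 0 < ∑ i, (-(a * p i) * exp (-((a + b) * u)) + b * r i)
        / (1 + (κ + p i * exp (-(a * u)) + r i * exp (b * u)) ^ 2) := by
  rw [phaseVelocity_eq_exp_mul]
  exact mul_pos_iff_of_pos_left (exp_pos _)

/-- the zeros of `Θ'` are the zeros of `R`. [this file's lemma] -/
theorem phaseVelocity_eq_zero_iff (a b κ u : ℝ) (p r : ι → ℝ) :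
    ∑ i, (-(a * p i) * exp (-(a * u)) + b * r i * exp (b * u))
        / (1 + (κ + p i * exp (-(a * u)) + r i * exp (b * u)) ^ 2) = 0
      ↔ ∑ i, (-(a * p i) * exp (-((a + b) * u)) + b * r i)
        / (1 + (κ + p i * exp (-(a * u)) + r i * exp (b * u)) ^ 2) = 0 := by
  rw [phaseVelocity_eq_exp_mul, mul_eq_zero]
  simp [(exp_pos _).ne']

/-- derivative of the envelope coefficient `c(u) = -a p e^{-(a+b)u} + b r`. [this file's lemma] -/
theorem hasDerivAt_coeff (a b p r u : ℝ) :
    HasDerivAt (fun u => -(a * p) * exp (-((a + b) * u)) + b * r)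
      (a * (a + b) * p * exp (-((a + b) * u))) u := by
  have h1 : HasDerivAt (fun u : ℝ => -((a + b) * u)) (-(a + b)) u := by
    have h0 : HasDerivAt (fun u : ℝ => (a + b) * u) (a + b) u := by
      simpa using (hasDerivAt_id u).const_mul (a + b)
    exact h0.neg
  have h2 : HasDerivAt (fun u : ℝ => exp (-((a + b) * u))) (exp (-((a + b) * u)) * (-(a + b))) u :=
    h1.exp
  have h3 := (h2.const_mul (-(a * p))).add_const (b * r)
  exact h3.congr_deriv (by ring)

/-- **Derivative of one summand of the reduced velocity** `c_i/(1 + y_i²)` (quotient rule, raw form).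
[this file's lemma] -/
theorem hasDerivAt_reducedSummand (a b κ p r u : ℝ) :
    HasDerivAt (fun u => (-(a * p) * exp (-((a + b) * u)) + b * r)
        / (1 + (κ + p * exp (-(a * u)) + r * exp (b * u)) ^ 2))
      (((a * (a + b) * p * exp (-((a + b) * u))) * (1 + (κ + p * exp (-(a * u)) + r * exp (b * u)) ^ 2)
        - (-(a * p) * exp (-((a + b) * u)) + b * r)
          * (2 * (κ + p * exp (-(a * u)) + r * exp (b * u))
            * (-(a * p) * exp (-(a * u)) + b * r * exp (b * u))))
        / (1 + (κ + p * exp (-(a * u)) + r * exp (b * u)) ^ 2) ^ 2) u := by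
  have hc := hasDerivAt_coeff a b p r u
  have hy := hasDerivAt_row a b κ p r u
  have hd : HasDerivAt (fun u => 1 + (κ + p * exp (-(a * u)) + r * exp (b * u)) ^ 2)
      (2 * (κ + p * exp (-(a * u)) + r * exp (b * u))
        * (-(a * p) * exp (-(a * u)) + b * r * exp (b * u))) u := by
    refine ((hy.pow 2).const_add 1).congr_deriv ?_
    norm_num
  have hne : (1 + (κ + p * exp (-(a * u)) + r * exp (b * u)) ^ 2) ≠ 0 := by positivity
  exact hc.div hd hne

/-- **The cross term is a square times the phase**: with `y' = e^{bu}·c`,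
`c·(2 y y') = 2 e^{bu} y c²`. [this file's lemma] -/
theorem crossTerm_eq (a b κ p r u : ℝ) :
    (-(a * p) * exp (-((a + b) * u)) + b * r)
        * (2 * (κ + p * exp (-(a * u)) + r * exp (b * u))
          * (-(a * p) * exp (-(a * u)) + b * r * exp (b * u)))
      = 2 * exp (b * u) * (κ + p * exp (-(a * u)) + r * exp (b * u))
          * (-(a * p) * exp (-((a + b) * u)) + b * r) ^ 2 := by
  rw [rowVelocity_eq]
  ring

/-- **PHASE-MONOTONICITY LAW, one row**: a lower-opposed row (`p ≤ 0`) at positive phase (`y(u) ≥ 0`) has a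
non-increasing reduced-velocity summand (`a, b ≥ 0`... here `0 ≤ a`, `0 ≤ a + b`). [this file's theorem] -/
theorem reducedSummand_deriv_nonpos (a b κ p r u : ℝ) (ha : 0 ≤ a) (hab : 0 ≤ a + b) (hp : p ≤ 0)
    (hy : 0 ≤ κ + p * exp (-(a * u)) + r * exp (b * u)) :
    ((a * (a + b) * p * exp (-((a + b) * u))) * (1 + (κ + p * exp (-(a * u)) + r * exp (b * u)) ^ 2)
        - (-(a * p) * exp (-((a + b) * u)) + b * r)
          * (2 * (κ + p * exp (-(a * u)) + r * exp (b * u))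
            * (-(a * p) * exp (-(a * u)) + b * r * exp (b * u))))
        / (1 + (κ + p * exp (-(a * u)) + r * exp (b * u)) ^ 2) ^ 2 ≤ 0 := by
  rw [crossTerm_eq]
  apply div_nonpos_of_nonpos_of_nonneg _ (by positivity)
  have h1 : a * (a + b) * p * exp (-((a + b) * u)) * (1 + (κ + p * exp (-(a * u)) + r * exp (b * u)) ^ 2)
      ≤ 0 := by
    have : a * (a + b) * p ≤ 0 := mul_nonpos_of_nonneg_of_nonpos (mul_nonneg ha hab) hp
    have := mul_nonpos_of_nonpos_of_nonneg this (exp_pos (-((a + b) * u))).le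
    exact mul_nonpos_of_nonpos_of_nonneg this (by positivity)
  have h2 : 0 ≤ 2 * exp (b * u) * (κ + p * exp (-(a * u)) + r * exp (b * u))
      * (-(a * p) * exp (-((a + b) * u)) + b * r) ^ 2 := by
    have : 0 ≤ 2 * exp (b * u) * (κ + p * exp (-(a * u)) + r * exp (b * u)) :=
      mul_nonneg (by positivity) hy
    exact mul_nonneg this (sq_nonneg _)
  linarith

/-- strict version: `p < 0`, `0 < a`, `0 < a + b`. [this file's theorem] -/
theorem reducedSummand_deriv_neg (a b κ p r u : ℝ) (ha : 0 < a) (hab : 0 < a + b) (hp : p < 0)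
    (hy : 0 ≤ κ + p * exp (-(a * u)) + r * exp (b * u)) :
    ((a * (a + b) * p * exp (-((a + b) * u))) * (1 + (κ + p * exp (-(a * u)) + r * exp (b * u)) ^ 2)
        - (-(a * p) * exp (-((a + b) * u)) + b * r)
          * (2 * (κ + p * exp (-(a * u)) + r * exp (b * u))
            * (-(a * p) * exp (-(a * u)) + b * r * exp (b * u))))
        / (1 + (κ + p * exp (-(a * u)) + r * exp (b * u)) ^ 2) ^ 2 < 0 := by
  rw [crossTerm_eq]
  apply div_neg_of_neg_of_pos _ (by positivity)
  have h1 : a * (a + b) * p * exp (-((a + b) * u)) * (1 + (κ + p * exp (-(a * u)) + r * exp (b * u)) ^ 2)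
      < 0 := by
    have : a * (a + b) * p < 0 := mul_neg_of_pos_of_neg (mul_pos ha hab) hp
    have := mul_neg_of_neg_of_pos this (exp_pos (-((a + b) * u)))
    exact mul_neg_of_neg_of_pos this (by positivity)
  have h2 : 0 ≤ 2 * exp (b * u) * (κ + p * exp (-(a * u)) + r * exp (b * u))
      * (-(a * p) * exp (-((a + b) * u)) + b * r) ^ 2 := by
    have : 0 ≤ 2 * exp (b * u) * (κ + p * exp (-(a * u)) + r * exp (b * u)) :=
      mul_nonneg (by positivity) hy
    exact mul_nonneg this (sq_nonneg _)
  linarith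

/-- **Derivative of the reduced velocity of a company.** [this file's theorem] -/
theorem hasDerivAt_reducedVelocity (a b κ u : ℝ) (p r : ι → ℝ) :
    HasDerivAt (fun u => ∑ i, (-(a * p i) * exp (-((a + b) * u)) + b * r i)
        / (1 + (κ + p i * exp (-(a * u)) + r i * exp (b * u)) ^ 2))
      (∑ i, ((a * (a + b) * p i * exp (-((a + b) * u)))
          * (1 + (κ + p i * exp (-(a * u)) + r i * exp (b * u)) ^ 2)
        - (-(a * p i) * exp (-((a + b) * u)) + b * r i)
          * (2 * (κ + p i * exp (-(a * u)) + r i * exp (b * u))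
            * (-(a * p i) * exp (-(a * u)) + b * r i * exp (b * u))))
        / (1 + (κ + p i * exp (-(a * u)) + r i * exp (b * u)) ^ 2) ^ 2) u := by
  have h := HasDerivAt.sum (u := (Finset.univ : Finset ι))
    (fun i _ => hasDerivAt_reducedSummand a b κ (p i) (r i) u)
  have e : (∑ i, fun v : ℝ => (-(a * p i) * exp (-((a + b) * v)) + b * r i)
        / (1 + (κ + p i * exp (-(a * v)) + r i * exp (b * v)) ^ 2))
      = fun v => ∑ i, (-(a * p i) * exp (-((a + b) * v)) + b * r i)
        / (1 + (κ + p i * exp (-(a * v)) + r i * exp (b * v)) ^ 2) := by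
    funext v
    exact Finset.sum_apply v Finset.univ _
  rw [e] at h
  exact h

/-- **PHASE-MONOTONICITY LAW, company form**: lower-opposed company (`p_i ≤ 0`) at a positive-phase point
(`y_i(u) ≥ 0` for all rows) ⇒ `R'(u) ≤ 0`. [this file's theorem] -/
theorem reducedVelocity_deriv_nonpos (a b κ u : ℝ) (p r : ι → ℝ) (ha : 0 ≤ a) (hab : 0 ≤ a + b)
    (hp : ∀ i, p i ≤ 0) (hy : ∀ i, 0 ≤ κ + p i * exp (-(a * u)) + r i * exp (b * u)) :
    (∑ i, ((a * (a + b) * p i * exp (-((a + b) * u)))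
          * (1 + (κ + p i * exp (-(a * u)) + r i * exp (b * u)) ^ 2)
        - (-(a * p i) * exp (-((a + b) * u)) + b * r i)
          * (2 * (κ + p i * exp (-(a * u)) + r i * exp (b * u))
            * (-(a * p i) * exp (-(a * u)) + b * r i * exp (b * u))))
        / (1 + (κ + p i * exp (-(a * u)) + r i * exp (b * u)) ^ 2) ^ 2) ≤ 0 :=
  Finset.sum_nonpos fun i _ => reducedSummand_deriv_nonpos a b κ (p i) (r i) u ha hab (hp i) (hy i)

/-- strict company form: in addition one row has `p_{i₀} < 0` and `0 < a`, `0 < a + b` ⇒ `R'(u) < 0`.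
[this file's theorem] -/
theorem reducedVelocity_deriv_neg (a b κ u : ℝ) (p r : ι → ℝ) (ha : 0 < a) (hab : 0 < a + b)
    (hp : ∀ i, p i ≤ 0) (i₀ : ι) (hi₀ : p i₀ < 0)
    (hy : ∀ i, 0 ≤ κ + p i * exp (-(a * u)) + r i * exp (b * u)) :
    (∑ i, ((a * (a + b) * p i * exp (-((a + b) * u)))
          * (1 + (κ + p i * exp (-(a * u)) + r i * exp (b * u)) ^ 2)
        - (-(a * p i) * exp (-((a + b) * u)) + b * r i)
          * (2 * (κ + p i * exp (-(a * u)) + r i * exp (b * u))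
            * (-(a * p i) * exp (-(a * u)) + b * r i * exp (b * u))))
        / (1 + (κ + p i * exp (-(a * u)) + r i * exp (b * u)) ^ 2) ^ 2) < 0 := by
  have hle := fun i (_ : i ∈ (Finset.univ : Finset ι)) =>
    reducedSummand_deriv_nonpos a b κ (p i) (r i) u ha.le hab.le (hp i) (hy i)
  have hlt := reducedSummand_deriv_neg a b κ (p i₀) (r i₀) u ha hab hi₀ (hy i₀)
  have hpos := Finset.sum_pos' (fun i hi => neg_nonneg.mpr (hle i hi)) ⟨i₀, Finset.mem_univ _, neg_pos.mpr hlt⟩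
  rw [Finset.sum_neg_distrib] at hpos
  exact neg_pos.mp hpos

/-- **POSITIVE-PHASE WINDOW LAW**: on a convex window `W` on which every row of a lower-opposed company
(`p_i ≤ 0`, some `p_{i₀} < 0`) stays at positive phase, the reduced velocity is STRICTLY DECREASING.
[this file's theorem] -/
theorem reducedVelocity_strictAntiOn (a b κ : ℝ) (p r : ι → ℝ) (ha : 0 < a) (hab : 0 < a + b)
    (hp : ∀ i, p i ≤ 0) (i₀ : ι) (hi₀ : p i₀ < 0) (W : Set ℝ) (hW : Convex ℝ W)
    (hy : ∀ u ∈ W, ∀ i, 0 ≤ κ + p i * exp (-(a * u)) + r i * exp (b * u)) :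
    StrictAntiOn (fun u => ∑ i, (-(a * p i) * exp (-((a + b) * u)) + b * r i)
        / (1 + (κ + p i * exp (-(a * u)) + r i * exp (b * u)) ^ 2)) W := by
  apply strictAntiOn_of_deriv_neg hW
  · exact fun u _ => (hasDerivAt_reducedVelocity a b κ u p r).continuousAt.continuousWithinAt
  · intro u hu
    rw [(hasDerivAt_reducedVelocity a b κ u p r).deriv]
    exact reducedVelocity_deriv_neg a b κ u p r ha hab hp i₀ hi₀ (hy u (interior_subset hu))

/-- **Consequence for (CL-1′)**: on such a window the phase velocity `Θ' = -F₁` vanishes AT MOST ONCE.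
[this file's theorem] -/
theorem phaseVelocity_zero_subsingleton (a b κ : ℝ) (p r : ι → ℝ) (ha : 0 < a) (hab : 0 < a + b)
    (hp : ∀ i, p i ≤ 0) (i₀ : ι) (hi₀ : p i₀ < 0) (W : Set ℝ) (hW : Convex ℝ W)
    (hy : ∀ u ∈ W, ∀ i, 0 ≤ κ + p i * exp (-(a * u)) + r i * exp (b * u)) :
    {u ∈ W | ∑ i, (-(a * p i) * exp (-(a * u)) + b * r i * exp (b * u))
        / (1 + (κ + p i * exp (-(a * u)) + r i * exp (b * u)) ^ 2) = 0}.Subsingleton := by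
  intro u hu v hv
  rw [Set.mem_setOf_eq, phaseVelocity_eq_zero_iff] at hu hv
  exact (reducedVelocity_strictAntiOn a b κ p r ha hab hp i₀ hi₀ W hW hy).injOn hu.1 hv.1
    (hu.2.trans hv.2.symm)

/-- **… and changes sign at most once, downward**: if `Θ'(u) ≤ 0` at a point `u` of the window then
`Θ'(v) < 0` at every later point `v` of the window. [this file's theorem] -/
theorem phaseVelocity_neg_of_le (a b κ : ℝ) (p r : ι → ℝ) (ha : 0 < a) (hab : 0 < a + b)
    (hp : ∀ i, p i ≤ 0) (i₀ : ι) (hi₀ : p i₀ < 0) (W : Set ℝ) (hW : Convex ℝ W)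
    (hy : ∀ u ∈ W, ∀ i, 0 ≤ κ + p i * exp (-(a * u)) + r i * exp (b * u))
    {u v : ℝ} (hu : u ∈ W) (hv : v ∈ W) (huv : u < v)
    (h : ∑ i, (-(a * p i) * exp (-(a * u)) + b * r i * exp (b * u))
        / (1 + (κ + p i * exp (-(a * u)) + r i * exp (b * u)) ^ 2) ≤ 0) :
    ∑ i, (-(a * p i) * exp (-(a * v)) + b * r i * exp (b * v))
        / (1 + (κ + p i * exp (-(a * v)) + r i * exp (b * v)) ^ 2) < 0 := by
  have hmono := reducedVelocity_strictAntiOn a b κ p r ha hab hp i₀ hi₀ W hW hy hu hv huv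
  rw [phaseVelocity_eq_exp_mul] at h ⊢
  have h' : ∑ i, (-(a * p i) * exp (-((a + b) * u)) + b * r i)
      / (1 + (κ + p i * exp (-(a * u)) + r i * exp (b * u)) ^ 2) ≤ 0 := by
    rw [← mul_zero (exp (b * u))] at h
    exact le_of_mul_le_mul_left h (exp_pos _)
  exact mul_neg_of_pos_of_neg (exp_pos _) (lt_of_lt_of_le hmono h')

end Summit.ValiantsHypothesis.ValiantsHypothesis.Theorems.LacunarySymmetroidMatrixDescartes.ProductPlusOne.LensCloudEnvelope
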